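import Mathlib

/-!
# Reimer's inequality for increasing events, counting form (blind cell PercRepro2, mine-1)

Configurations are finite sets `S ⊆ U` of open ("red") coordinates of a ground set `U`; the complement
`U \ S` is the blue set.  For increasing events `A`, `B` (sets of configurations closed upwards),
`DOcc A B S` ("`A` and `B` occur disjointly in `S`") means that `S` contains disjoint up-witnesses
`K`, `L` of `A` and `B`.

* `reimer_increasing` — `|{S ⊆ U : A □ B at S}| ≤ |{S ⊆ U : S ∈ A, U \ S ∈ B}|`
  (van den Berg–Kesten / Reimer for increasing events, counting form; the Bollobás–Leader induction
  on the ground set).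
* the restriction to non-constant traces (`MINE-1.md` Theorem 14.4) is in `ReimerNonConstant.lean`.
-/

namespace Summit.Ventures.PercRepro2

namespace ReimerCube

variable {E : Type*}

/-- An event (a set of configurations) is increasing if it is closed under enlarging the red set. -/
def Incr (A : Finset E → Prop) : Prop := ∀ ⦃S T : Finset E⦄, S ⊆ T → A S → A T

/-- Disjoint occurrence of two increasing events at the configuration `S`: `S` contains disjoint
sets `K`, `L` such that every configuration containing `K` lies in `A` and every configuration
containing `L` lies in `B`. -/
def DOcc (A B : Finset E → Prop) (S : Finset E) : Prop :=
  ∃ K L : Finset E, K ⊆ S ∧ L ⊆ S ∧ Disjoint K L ∧ (∀ T, K ⊆ T → A T) ∧ (∀ T, L ⊆ T → B T)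

/-- Disjoint occurrence is monotone in the first event. -/
lemma DOcc.mono_left {A A' B : Finset E → Prop} (h : ∀ T, A T → A' T) {S : Finset E}
    (hS : DOcc A B S) : DOcc A' B S := by
  obtain ⟨K, L, hK, hL, hKL, hA, hB⟩ := hS
  exact ⟨K, L, hK, hL, hKL, fun T hT => h T (hA T hT), hB⟩

/-- Disjoint occurrence is monotone in the second event. -/
lemma DOcc.mono_right {A B B' : Finset E → Prop} (h : ∀ T, B T → B' T) {S : Finset E}
    (hS : DOcc A B S) : DOcc A B' S := by
  obtain ⟨K, L, hK, hL, hKL, hA, hB⟩ := hS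
  exact ⟨K, L, hK, hL, hKL, hA, fun T hT => h T (hB T hT)⟩

variable [DecidableEq E]

/-- The section of an event at `i` open: `S ↦ A (insert i S)`. -/
def sec1 (i : E) (A : Finset E → Prop) : Finset E → Prop := fun S => A (insert i S)

/-- The section at `i` open of an increasing event is increasing. -/
lemma incr_sec1 {A : Finset E → Prop} (hA : Incr A) (i : E) : Incr (sec1 i A) :=
  fun _ _ hST h => hA (Finset.insert_subset_insert i hST) h

/-- For increasing `A`, `A S` implies `A (insert i S)`. -/
lemma incr_le_sec1 {A : Finset E → Prop} (hA : Incr A) (i : E) (T : Finset E) (h : A T) :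
    sec1 i A T := hA (Finset.subset_insert i T) h

/-- Bollobás–Leader: the section at `i` open of `A □ B` is `A₀ □ B₁ ∪ A₁ □ B₀`
(here `A₀ = A`, `A₁ = sec1 i A`); valid for increasing `A`, `B` and `i ∉ S`. -/
lemma dOcc_insert_iff {A B : Finset E → Prop} (hB : Incr B) {i : E} {S : Finset E}
    (hi : i ∉ S) :
    DOcc A B (insert i S) ↔ DOcc A (sec1 i B) S ∨ DOcc (sec1 i A) B S := by
  constructor
  · rintro ⟨K, L, hK, hL, hKL, hAK, hBL⟩
    by_cases hiK : i ∈ K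
    · -- `i` is used by the `A`-witness
      have hiL : i ∉ L := fun hiL => Finset.disjoint_left.mp hKL hiK hiL
      refine Or.inr ⟨K.erase i, L, ?_, ?_, ?_, ?_, hBL⟩
      · intro x hx
        have hx' := hK (Finset.mem_of_mem_erase hx)
        rcases Finset.mem_insert.mp hx' with rfl | h
        · exact absurd rfl (Finset.ne_of_mem_erase hx)
        · exact h
      · intro x hx
        have hx' := hL hx
        rcases Finset.mem_insert.mp hx' with rfl | h
        · exact absurd hx hiL
        · exact h
      · exact Finset.disjoint_of_subset_left (Finset.erase_subset i K) hKL
      · intro T hT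
        apply hAK
        intro x hx
        by_cases hxi : x = i
        · subst hxi; exact Finset.mem_insert_self x T
        · exact Finset.mem_insert_of_mem (hT (Finset.mem_erase.mpr ⟨hxi, hx⟩))
    · by_cases hiL : i ∈ L
      · refine Or.inl ⟨K, L.erase i, ?_, ?_, ?_, hAK, ?_⟩
        · intro x hx
          rcases Finset.mem_insert.mp (hK hx) with rfl | h
          · exact absurd hx hiK
          · exact h
        · intro x hx
          rcases Finset.mem_insert.mp (hL (Finset.mem_of_mem_erase hx)) with rfl | h
          · exact absurd rfl (Finset.ne_of_mem_erase hx)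
          · exact h
        · exact Finset.disjoint_of_subset_right (Finset.erase_subset i L) hKL
        · intro T hT
          apply hBL
          intro x hx
          by_cases hxi : x = i
          · subst hxi; exact Finset.mem_insert_self x T
          · exact Finset.mem_insert_of_mem (hT (Finset.mem_erase.mpr ⟨hxi, hx⟩))
      · -- neither witness uses `i`
        refine Or.inl ⟨K, L, ?_, ?_, hKL, hAK, fun T hT => incr_le_sec1 hB i T (hBL T hT)⟩
        · intro x hx
          rcases Finset.mem_insert.mp (hK hx) with rfl | h
          · exact absurd hx hiK
          · exact h
        · intro x hx
          rcases Finset.mem_insert.mp (hL hx) with rfl | h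
          · exact absurd hx hiL
          · exact h
  · rintro (⟨K, L, hK, hL, hKL, hAK, hBL⟩ | ⟨K, L, hK, hL, hKL, hAK, hBL⟩)
    · -- `B`'s witness uses `i`
      have hiK : i ∉ K := fun h => hi (hK h)
      refine ⟨K, insert i L, hK.trans (Finset.subset_insert i S),
        Finset.insert_subset_insert i hL, ?_, hAK, ?_⟩
      · rw [Finset.disjoint_insert_right]; exact ⟨hiK, hKL⟩
      · intro T hT
        have h1 : L ⊆ T.erase i := by
          intro x hx
          exact Finset.mem_erase.mpr ⟨fun hxi => hi (hL (hxi ▸ hx)), hT (Finset.mem_insert_of_mem hx)⟩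
        have h2 := hBL (T.erase i) h1
        have h3 : insert i (T.erase i) = T := Finset.insert_erase (hT (Finset.mem_insert_self i L))
        simpa [sec1, h3] using h2
    · have hiL : i ∉ L := fun h => hi (hL h)
      refine ⟨insert i K, L, Finset.insert_subset_insert i hK, hL.trans (Finset.subset_insert i S),
        ?_, ?_, hBL⟩
      · rw [Finset.disjoint_insert_left]; exact ⟨hiL, hKL⟩
      · intro T hT
        have h1 : K ⊆ T.erase i := by
          intro x hx
          exact Finset.mem_erase.mpr ⟨fun hxi => hi (hK (hxi ▸ hx)), hT (Finset.mem_insert_of_mem hx)⟩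
        have h2 := hAK (T.erase i) h1
        have h3 : insert i (T.erase i) = T := Finset.insert_erase (hT (Finset.mem_insert_self i K))
        simpa [sec1, h3] using h2


/-! ## Counting over the powerset of `insert i U` -/

/-- Splitting a filtered count over `𝒫(insert i U)` into the configurations without `i` and those
with `i` (indexed by their trace on `U`). -/
lemma card_filter_powerset_insert {i : E} {U : Finset E} (hi : i ∉ U) (P : Finset E → Prop)
    [DecidablePred P] :
    ((insert i U).powerset.filter P).card
      = (U.powerset.filter P).card + (U.powerset.filter (fun S => P (insert i S))).card := by
  have hinj : Set.InjOn (insert i)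
      (↑(U.powerset.filter (fun S => P (insert i S))) : Set (Finset E)) := by
    intro S hS T hT hST
    have hS' : i ∉ S := fun h => hi (Finset.mem_powerset.mp (Finset.mem_filter.mp hS).1 h)
    have hT' : i ∉ T := fun h => hi (Finset.mem_powerset.mp (Finset.mem_filter.mp hT).1 h)
    have h := congrArg (fun X : Finset E => X.erase i) hST
    simpa [Finset.erase_insert hS', Finset.erase_insert hT'] using h
  have hdisj : Disjoint (U.powerset.filter P) ((U.powerset.image (insert i)).filter P) := by
    rw [Finset.disjoint_left]
    intro S hS hS'
    have h1 : i ∉ S := fun h => hi (Finset.mem_powerset.mp (Finset.mem_filter.mp hS).1 h)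
    obtain ⟨T, -, rfl⟩ := Finset.mem_image.mp (Finset.mem_filter.mp hS').1
    exact h1 (Finset.mem_insert_self i T)
  rw [Finset.powerset_insert, Finset.filter_union, Finset.card_union_of_disjoint hdisj,
    Finset.filter_image, Finset.card_image_of_injOn hinj]

/-- `(insert i U) \ S = insert i (U \ S)` for `S ⊆ U`, `i ∉ U`. -/
lemma insert_sdiff_of_not_mem' {i : E} {U S : Finset E} (hS : S ⊆ U) (hi : i ∉ U) :
    insert i U \ S = insert i (U \ S) := by
  ext x
  simp only [Finset.mem_sdiff, Finset.mem_insert]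
  constructor
  · rintro ⟨h1 | h1, h2⟩
    · exact Or.inl h1
    · exact Or.inr ⟨h1, h2⟩
  · rintro (rfl | ⟨h1, h2⟩)
    · exact ⟨Or.inl rfl, fun h => hi (hS h)⟩
    · exact ⟨Or.inr h1, h2⟩

/-- `(insert i U) \ (insert i S) = U \ S` for `i ∉ U`. -/
lemma insert_sdiff_insert' {i : E} {U S : Finset E} (hi : i ∉ U) :
    insert i U \ insert i S = U \ S := by
  ext x
  simp only [Finset.mem_sdiff, Finset.mem_insert, not_or]
  constructor
  · rintro ⟨h1 | h1, h2, h3⟩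
    · exact absurd h1 h2
    · exact ⟨h1, h3⟩
  · rintro ⟨h1, h2⟩
    exact ⟨Or.inr h1, fun h => hi (h ▸ h1), h2⟩

/-! ## Reimer's inequality for increasing events (counting form) -/

open Classical in
/-- **Reimer / van den Berg–Kesten (increasing events, counting form).**  For increasing `A`, `B` and a
ground set `U`: `#{S ⊆ U : A □ B at S} ≤ #{S ⊆ U : S ∈ A ∧ U \ S ∈ B}`. -/
theorem reimer_increasing (U : Finset E) :
    ∀ (A B : Finset E → Prop), Incr A → Incr B →
      (U.powerset.filter (fun S => DOcc A B S)).card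
        ≤ (U.powerset.filter (fun S => A S ∧ B (U \ S))).card := by
  induction U using Finset.induction_on with
  | empty =>
    intro A B _ _
    apply Finset.card_le_card
    intro S hS
    rw [Finset.mem_filter, Finset.mem_powerset] at hS ⊢
    obtain ⟨hS0, K, L, hK, hL, -, hAK, hBL⟩ := hS
    have hS0' : S = ∅ := Finset.subset_empty.mp hS0
    rw [hS0'] at hL
    exact ⟨hS0, hAK S hK, hBL _ (hL.trans (Finset.empty_subset _))⟩
  | insert i U hi ih =>
    intro A B hA hB
    rw [card_filter_powerset_insert hi, card_filter_powerset_insert hi]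
    -- rewrite the four filters on `𝒫(U)`
    have e1 : U.powerset.filter (fun S => DOcc A B (insert i S))
        = U.powerset.filter (fun S => DOcc A (sec1 i B) S ∨ DOcc (sec1 i A) B S) := by
      apply Finset.filter_congr
      intro S hS
      exact dOcc_insert_iff hB (fun h => hi (Finset.mem_powerset.mp hS h))
    have e2 : U.powerset.filter (fun S => A S ∧ B (insert i U \ S))
        = U.powerset.filter (fun S => A S ∧ sec1 i B (U \ S)) := by
      apply Finset.filter_congr
      intro S hS
      rw [insert_sdiff_of_not_mem' (Finset.mem_powerset.mp hS) hi]
      rfl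
    have e3 : U.powerset.filter (fun S => A (insert i S) ∧ B (insert i U \ insert i S))
        = U.powerset.filter (fun S => sec1 i A S ∧ B (U \ S)) := by
      apply Finset.filter_congr
      intro S _
      rw [insert_sdiff_insert' hi]
      rfl
    rw [e1, e2, e3]
    -- inclusion–exclusion at level 1 and the containment `A₀ □ B₀ ⊆ A₀ □ B₁ ∩ A₁ □ B₀`
    have h_or : (U.powerset.filter (fun S => DOcc A (sec1 i B) S ∨ DOcc (sec1 i A) B S)).card
        + (U.powerset.filter (fun S => DOcc A (sec1 i B) S ∧ DOcc (sec1 i A) B S)).card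
        = (U.powerset.filter (fun S => DOcc A (sec1 i B) S)).card
          + (U.powerset.filter (fun S => DOcc (sec1 i A) B S)).card := by
      rw [Finset.filter_or, Finset.filter_and, Finset.card_union_add_card_inter]
    have h_sub : (U.powerset.filter (fun S => DOcc A B S)).card
        ≤ (U.powerset.filter (fun S => DOcc A (sec1 i B) S ∧ DOcc (sec1 i A) B S)).card := by
      apply Finset.card_le_card
      intro S hS
      rw [Finset.mem_filter] at hS ⊢
      exact ⟨hS.1, hS.2.mono_right (incr_le_sec1 hB i), hS.2.mono_left (incr_le_sec1 hA i)⟩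
    have ih1 := ih A (sec1 i B) hA (incr_sec1 hB i)
    have ih2 := ih (sec1 i A) B (incr_sec1 hA i) hB
    omega


end ReimerCube

end Summit.Ventures.PercRepro2
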